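import Mathlib

/-!
# A shrinking family of finite sets is eventually inside the limit (support, seat p1)

The combinatorial step of an «isolation by shrinking supports» argument: if `S N` is an antitone family
of sets with `S 0` finite and `⋂ N, S N ⊆ T`, then `S N ⊆ T` for all large `N`
(`eventually_subset_of_antitone_finite`). Corollaries: if moreover a fixed `γ₀` lies in every `S N` and the
intersection is `⊆ {γ₀}`, then `S N = {γ₀}` for `N` large (`eventually_eq_singleton`), and a sum over the finite
sets `Γ N` of any weights `w N γ` collapses to the single term `w N γ₀` for `N` large (`eventually_sum_eq_single`).

Pure combinatorics; nothing here is about any geometric or automorphic object.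
Blind lane: Mathlib only; no sorry; axioms ⊆ {propext, Classical.choice, Quot.sound}.
-/

namespace Summit.Ventures.HodgeRepro2.T7SupportShrinkingFiniteSets

variable {α : Type*}

/-- **Shrinking finite sets are eventually inside the limit.** For an antitone family `S : ℕ → Set α` with
`S 0` finite and `⋂ N, S N ⊆ T`, there is `N₀` with `S N ⊆ T` for every `N ≥ N₀`. -/
theorem eventually_subset_of_antitone_finite (S : ℕ → Set α) (hanti : Antitone S)
    (hfin : (S 0).Finite) (T : Set α) (hinter : (⋂ N, S N) ⊆ T) :
    ∃ N₀ : ℕ, ∀ N ≥ N₀, S N ⊆ T := by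
  classical
  have hB : (S 0 \ T).Finite := hfin.sdiff
  have hx : ∀ x ∈ S 0 \ T, ∃ N, x ∉ S N := by
    intro x hxB
    by_contra hcon
    push Not at hcon
    exact hxB.2 (hinter (Set.mem_iInter.2 hcon))
  choose! Nx hNx using hx
  refine ⟨hB.toFinset.sup Nx, fun N hN x hxN => ?_⟩
  by_contra hxT
  have hxB : x ∈ S 0 \ T := ⟨hanti (Nat.zero_le N) hxN, hxT⟩
  have hle : Nx x ≤ N := le_trans (Finset.le_sup (hB.mem_toFinset.2 hxB)) hN
  exact hNx x hxB (hanti hle hxN)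

/-- If moreover `γ₀ ∈ S N` for every `N` and `⋂ N, S N ⊆ {γ₀}`, then `S N = {γ₀}` for `N` large. -/
theorem eventually_eq_singleton (S : ℕ → Set α) (hanti : Antitone S) (hfin : (S 0).Finite)
    (γ₀ : α) (hγ₀ : ∀ N, γ₀ ∈ S N) (hinter : (⋂ N, S N) ⊆ {γ₀}) :
    ∃ N₀ : ℕ, ∀ N ≥ N₀, S N = {γ₀} := by
  obtain ⟨N₀, hN₀⟩ := eventually_subset_of_antitone_finite S hanti hfin {γ₀} hinter
  refine ⟨N₀, fun N hN => Set.Subset.antisymm (hN₀ N hN) ?_⟩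
  intro x hx
  rw [Set.mem_singleton_iff] at hx
  rw [hx]
  exact hγ₀ N

/-- **A sum over shrinking finite sets collapses to its distinguished term.** For finsets `Γ N` with
`Γ (N + 1) ⊆ Γ N`, `γ₀ ∈ Γ N` for all `N`, and `⋂ N, Γ N ⊆ {γ₀}`, every family of weights `w N γ` (in an
additive commutative monoid) has `∑ γ ∈ Γ N, w N γ = w N γ₀` for `N` large. -/
theorem eventually_sum_eq_single {M : Type*} [AddCommMonoid M] (Γ : ℕ → Finset α)
    (hanti : ∀ N, Γ (N + 1) ⊆ Γ N) (γ₀ : α) (hγ₀ : ∀ N, γ₀ ∈ Γ N)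
    (hinter : (⋂ N, (Γ N : Set α)) ⊆ {γ₀}) (w : ℕ → α → M) :
    ∃ N₀ : ℕ, ∀ N ≥ N₀, ∑ γ ∈ Γ N, w N γ = w N γ₀ := by
  have hanti' : Antitone fun N => (Γ N : Set α) := by
    refine antitone_nat_of_succ_le fun N => ?_
    exact_mod_cast hanti N
  obtain ⟨N₀, hN₀⟩ := eventually_eq_singleton (fun N => (Γ N : Set α)) hanti' (Finset.finite_toSet _)
    γ₀ (fun N => by exact_mod_cast hγ₀ N) hinter
  refine ⟨N₀, fun N hN => ?_⟩
  have hΓ : Γ N = {γ₀} := by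
    have := hN₀ N hN
    rw [← Finset.coe_singleton] at this
    exact_mod_cast this
  rw [hΓ, Finset.sum_singleton]

end Summit.Ventures.HodgeRepro2.T7SupportShrinkingFiniteSets
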